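import Summits.Ventures.PercRepro.RankLevelSetLevelEightArithMult4P
import Summits.Ventures.PercRepro.RankLevelSetLevelSevenMult4

/-!
# PercRepro — THEOREM C₈, CAP + LEMMA T + MULTIPLICITY + LEMMA T4: C-025 AT LEVEL `8` FOR EVERY FINITE MATROID AND
EVERY `p ≥ 1589`, UNCONDITIONAL (p9, S4)

`proofs/SUBCLAIM-S4-p9.md` §S4.1 (e). The level-`7` assembly of `RankLevelSetLevelSevenMult4` one level up: the flat
bound `f(8) ≤ 175` (one cover step from `f(7) ≤ 87`, `ncard_le_two_mul_add_one_of_free`), the core beyond corank `184`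
from `core_all_corank_of_thresholds_of_bound 8 175` (regime thresholds `N₁ = 237`, `P₂ = 202`; `2^8 + 2 = 258` binds),
and at coranks `9 … 184` night-1's split count with multiplicity (`ncard_eRk_eq_ncard_eq_mul_le`, summed over the sizes
by `ncard_eRk_eq_ncard_le_le_sum`) with the nullity cap `f = min 175 (8 + d)`, `f′ = min 87 (7 + d)`, Lemma T
`s₃ ≤ d(d+1)/2`, Lemma T4 `s₄ ≤ d(d+1)(d+2)/3`, `s_k ≤ C(d+k−1, k)` (`k = 5 … 9`), the tail
`16·Σ_{j ≤ 184} C(n, j) ≤ 2^n` (`n ≥ 557`), and the `176` polynomial inequalities `level_8_poly_mult4`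
(`RankLevelSetLevelEightArithMult4A … P`, in `ℚ`, the fibre sums bounded by their closed-form rows
`(2^{F+1} − 1)/(F + 1)`), which hold from `p ≥ 1588` (binding corank `d = 167`; `1587` fails there):
`c025_core_eight_bounded_corank_mult4` (corank `9 … 184`, `p ≥ 1588`), `c025_eight_of_seven_mult4` (level `7` for all
`p ≥ 1588` ⇒ level `8` for all `p ≥ 1589`) and, through this seat's level-`7` row `c025_seven_large_mult4'`
(`p ≥ 1226`), the UNCONDITIONAL `c025_eight_large_mult4' : 1589 ≤ p → RLS M p 8` — against THEOREM P‴'s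
`Tcap 8 = 41 943 040` and THEOREM P′'s `PexpS 8 ≈ 9.7·10^24`. Axioms: standard.
-/

open scoped Matroid

namespace PercRepro

namespace ThmN

open Set

variable {α : Type}

namespace Explicit

/-- `Σ_{k ∈ [3, 9]} g k = g 3 + … + g 9`. -/
theorem sum_Icc_three_nine (g : ℕ → ℕ) :
    ∑ k ∈ Finset.Icc 3 9, g k = g 3 + g 4 + g 5 + g 6 + g 7 + g 8 + g 9 := by
  rw [show (9 : ℕ) = 8 + 1 from rfl, Finset.sum_Icc_succ_top (by norm_num), sum_Icc_three_eight]

/-- `f(8) ≤ 175` on the `e`-free core: one cover step from `f(7) ≤ 87`. -/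
theorem ncard_le_one_seventy_five_of_free (M : Matroid α) [M.Finite]
    (hfree : ∀ e ∈ M.E, ∃ A ⊆ M.E \ {e}, e ∉ M.closure A ∧ e ∉ M.closure ((M.E \ {e}) \ A)) :
    ∀ X ⊆ M.E, M.eRk X ≤ 8 → X.ncard ≤ 175 := by
  intro X hX hr
  have := ncard_le_two_mul_add_one_of_free M hfree (k := 7) (B := 87)
    (fun _ hY hrY => ncard_le_eightyseven_of_free M hfree _ hY hrY) X hX hr
  omega

end Explicit

/-- **The `e`-free core at level `8` beyond corank `184`**: rank `p ≥ 258`, `|E| > p + 184` ⇒ C-025 at `(p, 8)`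
(`core_all_corank_of_thresholds_of_bound 8 175` with the flat bound `f(8) ≤ 175` and the regime thresholds
`N₁ = 237`, `P₂ = 202`; the third threshold `2^8 + 2 = 258` binds). -/
theorem c025_core_eight_beyond_one_eighty_four (M : Matroid α) [M.Finite] (p : ℕ) (hp : 258 ≤ p)
    (hR : M.eRank = (p : ℕ∞)) (hbig : p + 184 < M.E.ncard)
    (hfree : ∀ e ∈ M.E, ∃ A ⊆ M.E \ {e}, e ∉ M.closure A ∧ e ∉ M.closure ((M.E \ {e}) \ A)) : RLS M p 8 := by
  have hN₁ : ∀ n, 237 ≤ n → 8 * (8 + 1) * 2 ^ (175 - 8) * n ^ 8 ≤ 2 ^ n :=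
    mul_pow_le_two_pow_of_base (8 * (8 + 1) * 2 ^ (175 - 8)) 8 237 (by norm_num) (by norm_num) (by norm_num)
  have hP₂ := threshold_II_of_base 8 (2 ^ (175 - 8)) 202 (by norm_num) (by norm_num)
  have hmax : max (max 237 202) (2 ^ 8 + 2) = 258 := by decide
  have hBj : ∀ j : ℕ, j ≤ 8 → ∀ X ⊆ M.E, M.eRk X ≤ j → X.ncard + 8 ≤ 175 + j := by
    intro j hj X hX hr
    rcases Nat.lt_or_ge j 8 with h | h
    · have := ncard_add_one_le_two_pow_of_eRk_le M (not_isLoop_of_free M hfree) hfree j X hX hr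
      interval_cases j <;> omega
    · have hj8 : j = 8 := by omega
      subst hj8
      have := Explicit.ncard_le_one_seventy_five_of_free M hfree X hX hr
      omega
  exact core_all_corank_of_thresholds_of_bound 8 175 (by norm_num) (by norm_num) 237 202 hN₁ hP₂ M p
    (by rw [hmax]; exact hp) hR (by omega) hfree hBj

/-- **The `e`-free core at level `8`, corank `9 ≤ d ≤ 184`, rank `p ≥ 1588`** (split count, nullity cap, Lemma T,
multiplicity, Lemma T4). -/
theorem c025_core_eight_bounded_corank_mult4 (M : Matroid α) [M.Finite] (p d : ℕ) (hp : 1588 ≤ p) (hd9 : 9 ≤ d)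
    (hd184 : d ≤ 184) (hR : M.eRank = (p : ℕ∞)) (hn : M.E.ncard = p + d)
    (hfree : ∀ e ∈ M.E, ∃ A ⊆ M.E \ {e}, e ∉ M.closure A ∧ e ∉ M.closure ((M.E \ {e}) \ A)) :
    RLS M p 8 := by
  classical
  have hEcard : M.ground_finite.toFinset.card = p + d := by
    rw [← Set.ncard_eq_toFinset_card _ M.ground_finite]; exact hn
  -- the core is simple: every circuit has `≥ 3` elements
  have hL : ∀ e ∈ M.E, ¬ M.IsLoop e := not_isLoop_of_free M hfree
  have hs : ∀ e ∈ M.E, ∀ f ∈ M.E, e ≠ f → M.eRk {e, f} = 2 := by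
    intro e he f hf hef
    have h2 : (2 : ℕ∞) ≤ M.eRk {e, f} :=
      two_le_eRk_of_two_le_ncard_of_free M hfree (pair_subset he hf) (by rw [ncard_pair hef])
    have h3 : M.eRk {e, f} ≤ 2 := by
      have := M.eRk_le_encard {e, f}
      rwa [encard_pair hef] at this
    exact le_antisymm h3 h2
  have hcirc : ∀ C, M.IsCircuit C → 3 ≤ C.encard := three_le_encard_of_circuit M hL hs
  have hd : M.E.encard = M.eRank + d := by
    rw [hR, ← M.ground_finite.cast_ncard_eq, hn]
    push_cast
    ring
  -- the nullity cap: every `X ⊆ E` has `|X| ≤ r(X) + d`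
  have hcap : ∀ X ⊆ M.E, ∀ k : ℕ, M.eRk X ≤ k → X.ncard ≤ k + d := by
    intro X hX k hr
    have h1 := Matroid.encard_le_eRk_add_of_encard_eq hX hd
    have h2 : X.encard ≤ (k : ℕ∞) + d := h1.trans (by gcongr)
    have hfin : X.Finite := M.ground_finite.subset hX
    rw [← hfin.cast_ncard_eq] at h2
    exact_mod_cast h2
  -- rank-`≤ 8` sets have `≤ min 175 (8 + d)` points, rank-`≤ 7` sets `≤ min 87 (7 + d)`
  have hflat : ∀ X ⊆ M.E, M.eRk X ≤ 8 → X.ncard ≤ min 175 (8 + d) :=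
    fun X hX hr => le_min (Explicit.ncard_le_one_seventy_five_of_free M hfree X hX hr) (hcap X hX 8 hr)
  have hflat' : ∀ X ⊆ M.E, M.eRk X ≤ ((8 - 1 : ℕ) : ℕ∞) → X.ncard ≤ min 87 (7 + d) :=
    fun X hX hr => le_min (Explicit.ncard_le_eightyseven_of_free M hfree X hX (by simpa using hr))
      (hcap X hX 7 (by simpa using hr))
  -- (U)
  have hU1 := Matroid.topCount_le_ncard_compl (M := M) hR hd 8
  have hsum := Matroid.ncard_eRk_eq_ncard_le_le_sum (M := M) 8 d
  have hmul := fun m => Matroid.ncard_eRk_eq_ncard_eq_mul_le M 8 (min 175 (8 + d)) (min 87 (7 + d))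
    (by norm_num) hcirc hflat hflat' hd m
  have hC1 : ∀ L ⊆ M.E, M.eRk L = 2 → L.ncard ≤ 3 :=
    fun L hL hr => ncard_le_three_of_eRk_two M hs hfree hL hr
  have hs3 : {C | M.IsCircuit C ∧ C.ncard = 3}.ncard ≤ d * (d + 1) / 2 := by
    have hT : 2 * {C | M.IsCircuit C ∧ C.ncard = 3}.ncard ≤ d * (d + 1) := S1.two_mul_ncard_triangles_le M hC1 hd
    omega
  have hC2 : ∀ P ⊆ M.E, M.eRk P ≤ 3 → P.ncard ≤ 6 :=
    fun P hP hr => ncard_le_six_of_eRk_le_three_of_free M hfree hP hr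
  have hC1' : ∀ L ⊆ M.E, M.eRk L ≤ 2 → L.ncard ≤ 3 := by
    intro L hL' hr
    have := ncard_add_one_le_two_pow_of_eRk_le M hL hfree 2 L hL' hr
    omega
  have hs4 : {C | M.IsCircuit C ∧ C.ncard = 4}.ncard ≤ d * (d + 1) * (d + 2) / 3 := by
    have hT4 : 3 * {C : Set α | M.IsCircuit C ∧ C.ncard = 4}.ncard ≤ d * (d + 1) * (d + 2) :=
      S1.three_mul_ncard_four_circuits_le M hC1' hC2 hd
    omega
  have hs5 : {C | M.IsCircuit C ∧ C.ncard = 5}.ncard ≤ (d + 4).choose 5 :=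
    Matroid.ncard_circuits_le_choose_of_encard M hd 4
  have hs6 : {C | M.IsCircuit C ∧ C.ncard = 6}.ncard ≤ (d + 5).choose 6 :=
    Matroid.ncard_circuits_le_choose_of_encard M hd 5
  have hs7 : {C | M.IsCircuit C ∧ C.ncard = 7}.ncard ≤ (d + 6).choose 7 :=
    Matroid.ncard_circuits_le_choose_of_encard M hd 6
  have hs8 : {C | M.IsCircuit C ∧ C.ncard = 8}.ncard ≤ (d + 7).choose 8 :=
    Matroid.ncard_circuits_le_choose_of_encard M hd 7
  have hs9 : {C | M.IsCircuit C ∧ C.ncard = 9}.ncard ≤ (d + 8).choose 9 :=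
    Matroid.ncard_circuits_le_choose_of_encard M hd 8
  -- the two pair sums, bounded
  set A : ℕ := ∑ k ∈ Finset.Icc 3 (8 + 1), {C | M.IsCircuit C ∧ C.ncard = k}.ncard * M.E.ncard.choose (8 + 1 - k)
    with hAdef
  set B : ℕ := ∑ k ∈ Finset.Icc 3 (8 + 1), {C | M.IsCircuit C ∧ C.ncard = k}.ncard * ((8 + 1) * d).choose (8 + 1 - k)
    with hBdef
  have hA : A ≤ d * (d + 1) / 2 * (p + d).choose 6 + d * (d + 1) * (d + 2) / 3 * (p + d).choose 5 + (d + 4).choose 5 * (p + d).choose 4 + (d + 5).choose 6 * (p + d).choose 3 + (d + 6).choose 7 * (p + d).choose 2 + (d + 7).choose 8 * (p + d) + (d + 8).choose 9 := by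
    rw [hAdef, Explicit.sum_Icc_three_nine, hn]
    simp only [show (8 : ℕ) + 1 - 3 = 6 from rfl, show (8 : ℕ) + 1 - 4 = 5 from rfl,
      show (8 : ℕ) + 1 - 5 = 4 from rfl, show (8 : ℕ) + 1 - 6 = 3 from rfl,
      show (8 : ℕ) + 1 - 7 = 2 from rfl, show (8 : ℕ) + 1 - 8 = 1 from rfl, show (8 : ℕ) + 1 - 9 = 0 from rfl,
      Nat.choose_one_right, Nat.choose_zero_right, mul_one]
    gcongr
  have hB : B ≤ d * (d + 1) / 2 * (9 * d).choose 6 + d * (d + 1) * (d + 2) / 3 * (9 * d).choose 5 + (d + 4).choose 5 * (9 * d).choose 4 + (d + 5).choose 6 * (9 * d).choose 3 + (d + 6).choose 7 * (9 * d).choose 2 + (d + 7).choose 8 * (9 * d) + (d + 8).choose 9 := by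
    rw [hBdef, Explicit.sum_Icc_three_nine]
    simp only [show (8 : ℕ) + 1 - 3 = 6 from rfl, show (8 : ℕ) + 1 - 4 = 5 from rfl,
      show (8 : ℕ) + 1 - 5 = 4 from rfl, show (8 : ℕ) + 1 - 6 = 3 from rfl,
      show (8 : ℕ) + 1 - 7 = 2 from rfl, show (8 : ℕ) + 1 - 8 = 1 from rfl, show (8 : ℕ) + 1 - 9 = 0 from rfl,
      Nat.choose_one_right, Nat.choose_zero_right, mul_one, show (8 : ℕ) + 1 = 9 from rfl]
    gcongr
  -- the level counts in `ℚ`, weighted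
  have hlevel : ∀ m ∈ Finset.Icc 9 d, ({X : Set α | X ⊆ M.E ∧ M.eRk X = 8 ∧ X.ncard = m}.ncard : ℚ) ≤
      (((min 87 (7 + d) - 8).choose (m - 9) : ℚ) * (A : ℚ) + ((min 175 (8 + d) - 9).choose (m - 9) : ℚ) * (B : ℚ)) /
        ((m - 8 : ℕ) : ℚ) := by
    intro m hm
    rw [Finset.mem_Icc] at hm
    have hpos : (0 : ℚ) < ((m - 8 : ℕ) : ℚ) := by exact_mod_cast (by omega : 0 < m - 8)
    rw [le_div_iff₀ hpos]
    have h := hmul m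
    simp only [show (8 : ℕ) + 1 = 9 from rfl] at h
    have h' : (((m - 8) * {X : Set α | X ⊆ M.E ∧ M.eRk X = 8 ∧ X.ncard = m}.ncard : ℕ) : ℚ) ≤
        (((min 87 (7 + d) - 8).choose (m - 9) * A + (min 175 (8 + d) - 9).choose (m - 9) * B : ℕ) : ℚ) := by
      exact_mod_cast h
    push_cast at h'
    linarith
  have hre : ∑ m ∈ Finset.Icc 9 d,
      (((min 87 (7 + d) - 8).choose (m - 9) : ℚ) * (A : ℚ) + ((min 175 (8 + d) - 9).choose (m - 9) : ℚ) * (B : ℚ)) /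
        ((m - 8 : ℕ) : ℚ) =
      ∑ j ∈ Finset.range (d - 8),
      (((min 87 (7 + d) - 8).choose j : ℚ) * (A : ℚ) + ((min 175 (8 + d) - 9).choose j : ℚ) * (B : ℚ)) / ((j : ℚ) + 1) := by
    rw [show Finset.Icc 9 d = Finset.image (fun j => 9 + j) (Finset.range (d - 8)) from ?_]
    · rw [Finset.sum_image (fun a _ b _ h => by omega)]
      apply Finset.sum_congr rfl
      intro j _
      rw [show 9 + j - 9 = j by omega, show 9 + j - 8 = j + 1 by omega]
      push_cast
      ring
    · ext m
      rw [Finset.mem_Icc, Finset.mem_image]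
      constructor
      · intro hm
        exact ⟨m - 9, by rw [Finset.mem_range]; omega, by omega⟩
      · rintro ⟨j, hj, rfl⟩
        rw [Finset.mem_range] at hj
        omega
  have hrange : Finset.range (d - 8) ⊆ Finset.range (d - 9 + 1) := Finset.range_mono (by omega)
  have hUq : (Matroid.topCount M p 8 : ℚ) ≤ ((p + d).choose 8 : ℚ) +
      ((∑ j ∈ Finset.range (d - 9 + 1), ((Nat.choose (min 87 (7 + d) - 8) j : ℕ) : ℚ) / ((j : ℚ) + 1)) * (((d * (d + 1) / 2 : ℕ) : ℚ) * ((p + d).choose 6 : ℚ) + ((d * (d + 1) * (d + 2) / 3 : ℕ) : ℚ) * ((p + d).choose 5 : ℚ) + (((d + 4).choose 5 : ℕ) : ℚ) * ((p + d).choose 4 : ℚ) + (((d + 5).choose 6 : ℕ) : ℚ) * ((p + d).choose 3 : ℚ) + (((d + 6).choose 7 : ℕ) : ℚ) * ((p + d).choose 2 : ℚ) + (((d + 7).choose 8 : ℕ) : ℚ) * (p + d : ℚ) + (((d + 8).choose 9 : ℕ) : ℚ)) + (∑ j ∈ Finset.range (d - 9 + 1), ((Nat.choose (min 175 (8 + d)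 - 9) j : ℕ) : ℚ) / ((j : ℚ) + 1)) * (((d * (d + 1) / 2 : ℕ) : ℚ) * ((9 * d).choose 6 : ℚ) + ((d * (d + 1) * (d + 2) / 3 : ℕ) : ℚ) * ((9 * d).choose 5 : ℚ) + (((d + 4).choose 5 : ℕ) : ℚ) * ((9 * d).choose 4 : ℚ) + (((d + 5).choose 6 : ℕ) : ℚ) * ((9 * d).choose 3 : ℚ) + (((d + 6).choose 7 : ℕ) : ℚ) * ((9 * d).choose 2 : ℚ) + (((d + 7).choose 8 : ℕ) : ℚ) * (9 * d : ℚ) + (((d + 8).choose 9 : ℕ) : ℚ))) := by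
    have h1 : (Matroid.topCount M p 8 : ℚ) ≤ ((p + d).choose 8 : ℚ) +
        ∑ m ∈ Finset.Icc 9 d, ({X : Set α | X ⊆ M.E ∧ M.eRk X = 8 ∧ X.ncard = m}.ncard : ℚ) := by
      have := hU1.trans hsum
      rw [hn] at this
      simp only [show (8 : ℕ) + 1 = 9 from rfl] at this
      exact_mod_cast this
    have hAq : (A : ℚ) ≤ (((d * (d + 1) / 2 : ℕ) : ℚ) * ((p + d).choose 6 : ℚ) + ((d * (d + 1) * (d + 2) / 3 : ℕ) : ℚ) * ((p + d).choose 5 : ℚ) + (((d + 4).choose 5 : ℕ) : ℚ) * ((p + d).choose 4 : ℚ) + (((d + 5).choose 6 : ℕ) : ℚ) * ((p + d).choose 3 : ℚ) + (((d + 6).choose 7 : ℕ) : ℚ) * ((p + d).choose 2 : ℚ) + (((d + 7).choose 8 : ℕ) : ℚ) * (p + d : ℚ) + (((d + 8).choose 9 : ℕ) : ℚ)) := by exact_mod_cast hA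
    have hBq : (B : ℚ) ≤ (((d * (d + 1) / 2 : ℕ) : ℚ) * ((9 * d).choose 6 : ℚ) + ((d * (d + 1) * (d + 2) / 3 : ℕ) : ℚ) * ((9 * d).choose 5 : ℚ) + (((d + 4).choose 5 : ℕ) : ℚ) * ((9 * d).choose 4 : ℚ) + (((d + 5).choose 6 : ℕ) : ℚ) * ((9 * d).choose 3 : ℚ) + (((d + 6).choose 7 : ℕ) : ℚ) * ((9 * d).choose 2 : ℚ) + (((d + 7).choose 8 : ℕ) : ℚ) * (9 * d : ℚ) + (((d + 8).choose 9 : ℕ) : ℚ)) := by exact_mod_cast hB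
    have hσs0 : (0 : ℚ) ≤ (∑ j ∈ Finset.range (d - 9 + 1), ((Nat.choose (min 87 (7 + d) - 8) j : ℕ) : ℚ) / ((j : ℚ) + 1)) :=
      Finset.sum_nonneg (fun j _ => by positivity)
    have hσ0 : (0 : ℚ) ≤ (∑ j ∈ Finset.range (d - 9 + 1), ((Nat.choose (min 175 (8 + d) - 9) j : ℕ) : ℚ) / ((j : ℚ) + 1)) :=
      Finset.sum_nonneg (fun j _ => by positivity)
    have h2 : ∑ m ∈ Finset.Icc 9 d, ({X : Set α | X ⊆ M.E ∧ M.eRk X = 8 ∧ X.ncard = m}.ncard : ℚ) ≤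
        (∑ j ∈ Finset.range (d - 9 + 1), ((Nat.choose (min 87 (7 + d) - 8) j : ℕ) : ℚ) / ((j : ℚ) + 1)) * (A : ℚ) + (∑ j ∈ Finset.range (d - 9 + 1), ((Nat.choose (min 175 (8 + d) - 9) j : ℕ) : ℚ) / ((j : ℚ) + 1)) * (B : ℚ) := by
      rw [Finset.sum_mul, Finset.sum_mul, ← Finset.sum_add_distrib]
      refine (Finset.sum_le_sum hlevel).trans (hre.le.trans ?_)
      refine Finset.sum_le_sum_of_subset_of_nonneg hrange (fun j _ _ => by positivity) |>.trans' ?_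
      apply le_of_eq
      apply Finset.sum_congr rfl
      intro j _
      field_simp
    have e1 := mul_le_mul_of_nonneg_left hAq hσs0
    have e2 := mul_le_mul_of_nonneg_left hBq hσ0
    linarith
  -- (Y)
  have hY := Matroid.two_pow_le_midCount_add (M := M) p 8 hR
  have hA : {X : Set α | X ⊆ M.E ∧ M.eRk X ≤ 8}.ncard ≤ ∑ j ∈ Finset.range (175 + 1), (p + d).choose j := by
    calc {X : Set α | X ⊆ M.E ∧ M.eRk X ≤ 8}.ncard
        ≤ {X : Set α | X ⊆ (M.ground_finite.toFinset : Set α) ∧ X.ncard ≤ 175}.ncard := by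
          apply ncard_le_ncard
          · intro X hX
            exact ⟨by rw [Set.Finite.coe_toFinset]; exact hX.1, (hflat X hX.1 hX.2).trans (min_le_left _ _)⟩
          · exact (Finset.finite_toSet _).finite_subsets.subset (fun X hX => hX.1)
      _ ≤ ∑ j ∈ Finset.range (175 + 1), M.ground_finite.toFinset.card.choose j :=
          ncard_subsets_ncard_le _ 175
      _ = ∑ j ∈ Finset.range (175 + 1), (p + d).choose j := by rw [hEcard]
  have hB := Matroid.ncard_spanning_le (M := M) hd
  rw [hEcard] at hY hB
  -- the tails: `16·Σ_{j ≤ 184} C(n, j) ≤ 2^n` for `n ≥ 557`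
  have hT : 16 * ∑ j ∈ Finset.range (184 + 1), (p + d).choose j ≤ 2 ^ (p + d) :=
    Explicit.sixteen_mul_sum_range_choose_le 184 (p + d) (by omega)
  have hA' : ∑ j ∈ Finset.range (175 + 1), (p + d).choose j ≤ ∑ j ∈ Finset.range (184 + 1), (p + d).choose j :=
    Finset.sum_le_sum_of_subset_of_nonneg (Finset.range_mono (by norm_num)) (fun _ _ _ => Nat.zero_le _)
  have hB' : ∑ j ∈ Finset.range (d + 1), (p + d).choose j ≤ ∑ j ∈ Finset.range (184 + 1), (p + d).choose j :=
    Finset.sum_le_sum_of_subset_of_nonneg (Finset.range_mono (by omega)) (fun _ _ _ => Nat.zero_le _)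
  have hAB : 8 * ({X : Set α | X ⊆ M.E ∧ M.eRk X ≤ 8}.ncard +
      {X : Set α | X ⊆ M.E ∧ M.eRk X = M.eRank}.ncard) ≤ 2 ^ (p + d) := by
    have h1 := hA.trans hA'
    have h2 := hB.trans hB'
    omega
  -- (Φ) and the polynomial inequality
  have hΦ := phiK_le_two_pow_div p 8
  rw [Nat.choose_symm_add] at hΦ
  have hpolyq := level_8_poly_mult4 d hd9 hd184 p hp
  rw [add_assoc] at hpolyq
  -- assemble in `ℚ`
  rw [RLS_iff]
  have hYq : (2 : ℚ) ^ (p + d) ≤ (Matroid.midCount M p 8 : ℚ) +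
      ({X : Set α | X ⊆ M.E ∧ M.eRk X ≤ 8}.ncard : ℚ) +
      ({X : Set α | X ⊆ M.E ∧ M.eRk X = M.eRank}.ncard : ℚ) := by exact_mod_cast hY
  have hABq : 8 * (({X : Set α | X ⊆ M.E ∧ M.eRk X ≤ 8}.ncard : ℚ) +
      ({X : Set α | X ⊆ M.E ∧ M.eRk X = M.eRank}.ncard : ℚ)) ≤ 2 ^ (p + d) := by exact_mod_cast hAB
  have hU0 : (0 : ℚ) ≤ (Matroid.topCount M p 8 : ℚ) := Nat.cast_nonneg _
  have hd8 : 8 ≤ d := by omega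
  exact level_arith (p := p) (d := d) (n := p + d) (q := 8) rfl hd8 hΦ hU0 hUq hYq hABq hpolyq

/-- **THEOREM C₈, CAP + LEMMA T + MULTIPLICITY + LEMMA T4, GIVEN LEVEL `7`**: level `7` for all `p ≥ 1588` implies
level `8` for all `p ≥ 1589`. -/
theorem c025_eight_of_seven_mult4 (h7 : ∀ (M : Matroid α) [M.Finite] (p : ℕ), 1588 ≤ p → RLS M p 7) :
    ∀ (M : Matroid α) [M.Finite] (p : ℕ), 1589 ≤ p → RLS M p 8 := by
  intro M _ p hp
  refine rls_succ_large (α := α) 7 8 1588 ?_ ?_ ?_ M p hp (by omega)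
  · -- level `7` for `p ≥ 1588`
    intro M' _ p' hP _
    exact h7 M' p' (by omega)
  · -- corank `≤ 8`: `U = ∅` or Theorem M
    intro M' _ p' _ hn _
    rcases Nat.lt_or_ge M'.E.ncard (p' + 8) with h | h
    · exact RLS_of_ncard_lt M' h
    · exact RLS_of_ncard_eq M' (by omega)
  · -- the core: coranks `9 … 184` by counting, coranks `≥ 185` beyond the flat bound
    intro M' _ p' hP hR hbig _ hfree
    rcases Nat.lt_or_ge M'.E.ncard (p' + 185) with h | h
    · exact c025_core_eight_bounded_corank_mult4 M' p' (M'.E.ncard - p') hP (by omega) (by omega) hR (by omega) hfree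
    · exact c025_core_eight_beyond_one_eighty_four M' p' (by omega) hR (by omega) hfree

/-- **THEOREM C₈, UNCONDITIONAL**: every finite matroid satisfies C-025 at level `8` for every `p ≥ 1589` — the
level-`7` row `c025_seven_large_mult4'` (`p ≥ 1226`) through the wrapper at `P = 1588`. -/
theorem c025_eight_large_mult4' (M : Matroid α) [M.Finite] (p : ℕ) (hp : 1589 ≤ p) : RLS M p 8 :=
  c025_eight_of_seven_mult4 (fun M' _ p' hp' => c025_seven_large_mult4' M' p' (by omega)) M p hp

/-- The same in the literal `C025` body: `phiK p 8 · #U(p, 8) ≤ #Y(p, 8)` for every finite matroid and every `p ≥ 1589`. -/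
theorem c025_eight_large_mult4 (M : Matroid α) [M.Finite] (p : ℕ) (hp : 1589 ≤ p) :
    phiK p 8 * ({A : Set α | A ⊆ M.E ∧ M.eRk A = (p : ℕ∞) ∧ M.eRk (M.E \ A) = (8 : ℕ∞)}.ncard : ℚ) ≤
      ({A : Set α | A ⊆ M.E ∧ (8 : ℕ∞) < M.eRk A ∧ M.eRk A < (p : ℕ∞)}.ncard : ℚ) :=
  c025_eight_large_mult4' M p hp

end ThmN

end PercRepro
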